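import Summits.ResolutionOfSingularities.ResolutionOfSingularities.Theses.RuledResidues
import Summits.ResolutionOfSingularities.ResolutionOfSingularities.Theorems.RuledResiduesNonRuledDivisorsStubTransportPlace

/-!
# `RuledResidues.NonRuledDivisors` — line `contracted-divisor`, stub `stub_transportLocal`

Strategist line `Cruxes/NonRuledDivisors/Lines/contracted-divisor.lean` (crux stmt-ResolutionOfSingularities-18075),
stub 2 proved verbatim (signature = the registered one), reusing the transport lemmas
`transportPlace_mem_comap`, `transportPlace_mem_nonunits_comap`, `transportPlace_dvr`,
`transportPlace_eft` of the landed `Theorems/RuledResiduesNonRuledDivisorsStubTransportPlace.lean`.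

Compared with `Theorems.stub_transportPlace` (line `automorphism-orbit`) the hypothesis `τ R ⊆ R`,
`τ P ⊆ P` is weakened to: `τ` induces a LOCAL endomorphism of `R_P` (`τ r = a/s`, `s ∉ P`,
`r ∈ P ↔ a ∈ P`), and the place `V` is asked to contain `R_P` (`R ⊆ V`, `R∖P ⊆ Vˣ`) with
`τ P ⊆ 𝔪_V`.  Then `V' = V.comap τ` contains `k` and `R_P`, is a DVR essentially of finite type
over `k`, dominates `P` (`r ∈ P ⇒ r ∈ 𝔪_{V'}` because `τ r ∈ 𝔪_V`), and `τ P ⊆ 𝔪_{V'}` because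
`τ (τ r) = τ a · (τ s)⁻¹` with `τ a ∈ 𝔪_V` and `τ s` a unit of `V`.
-/

-- dupNamespace: the problem namespace legitimately repeats the summit name
set_option linter.dupNamespace false

namespace Summit.ResolutionOfSingularities.ResolutionOfSingularities.Theorems

/-- Stub 2 of line `contracted-divisor` (crux `RuledResidues.NonRuledDivisors`): transport of the place data along `V ↦ V.comap τ` for a ring automorphism `τ` of `K`, semilinear over `ι`, inducing a local endomorphism of `R_P`; the pulled-back place contains `k` and `R_P`, is a DVR essentially of finite type over `k`, dominates `P`, and `τ P` lies in its maximal ideal. [folklore] -/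
theorem stub_transportLocal : ∀ (k K : Type) [Field k] [Field K] [Algebra k K] (R : Subalgebra k K) (P : Ideal R.toSubring) (τ : K ≃+* K) (ι : k ≃+* k), (∀ c : k, τ (algebraMap k K c) = algebraMap k K (ι c)) → (∀ r : R.toSubring, ∃ a s : R.toSubring, s ∉ P ∧ τ (r : K) * (s : K) = (a : K) ∧ (r ∈ P ↔ a ∈ P)) → ∀ (V V' : ValuationSubring K), V' = V.comap (τ : K →+* K) → (∀ c : k, algebraMap k K c ∈ V) → IsDiscreteValuationRing V → (∃ B : Subalgebra k K, B.FG ∧ B.toSubring ≤ V.toSubring ∧ ∀ x : K, x ∈ V → ∃ b s : K, b ∈ B ∧ s ∈ B ∧ s ∉ V.nonunits ∧ x * s = b) → R.toSubring ≤ V.toSubring → (∀ s : R.toSubring, s ∉ P → (s : K) ∉ V.nonunits) → (∀ r : R.toSubring, r ∈ P → τ (r : K) ∈ V.nonunits) → (∀ c : k, algebraMap k K c ∈ V') ∧ IsDiscreteValuationRing V' ∧ (∃ B : Subalgebra k K, B.FG ∧ B.toSubring ≤ V'.toSubring ∧ ∀ x : K, x ∈ V' → ∃ b s : K, b ∈ B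 ∧ s ∈ B ∧ s ∉ V'.nonunits ∧ x * s = b) ∧ R.toSubring ≤ V'.toSubring ∧ (∀ s : R.toSubring, s ∉ P → (s : K) ∉ V'.nonunits) ∧ (∀ r : R.toSubring, r ∈ P → (r : K) ∈ V'.nonunits) ∧ (∀ r : R.toSubring, r ∈ P → τ (r : K) ∈ V'.nonunits) := by
  intro k K _ _ _ R P τ ι hsemi hloc V V' hV' hk hdvr hft hle hunit hcon
  subst hV'
  -- elements of `R ∖ P` are nonzero units of `V`
  have hne : ∀ s : R.toSubring, s ∉ P → (s : K) ≠ 0 := by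
    intro s hs h0
    apply hs
    have : s = 0 := Subtype.ext h0
    rw [this]
    exact P.zero_mem
  have hvS : ∀ s : R.toSubring, s ∉ P → V.valuation (s : K) = 1 := by
    intro s hs
    apply le_antisymm
    · exact (V.valuation_le_one_iff _).mpr (hle s.2)
    · exact not_lt.mp fun h => hunit s hs ((V.mem_nonunits_iff).mpr h)
  -- `τ r = a · s⁻¹`
  have hτval : ∀ r : R.toSubring, ∃ a s : R.toSubring, s ∉ P ∧
      τ (r : K) = (a : K) * ((s : K))⁻¹ ∧ (r ∈ P ↔ a ∈ P) := by
    intro r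
    obtain ⟨a, s, hs, hrs, hiff⟩ := hloc r
    exact ⟨a, s, hs, by rw [eq_mul_inv_iff_mul_eq₀ (hne s hs), hrs], hiff⟩
  -- `τ R ⊆ V` and `τ (R ∖ P) ⊆ Vˣ`
  have hτR : ∀ r : R.toSubring, τ (r : K) ∈ V := by
    intro r
    obtain ⟨a, s, hs, hτr, -⟩ := hτval r
    rw [← V.valuation_le_one_iff, hτr, map_mul, map_inv₀, hvS s hs, inv_one, mul_one]
    exact (V.valuation_le_one_iff _).mpr (hle a.2)
  have hτunit : ∀ s : R.toSubring, s ∉ P → V.valuation (τ (s : K)) = 1 := by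
    intro s hs
    obtain ⟨a, s', hs', hτs, hiff⟩ := hτval s
    have ha : a ∉ P := fun h => hs (hiff.mpr h)
    rw [hτs, map_mul, map_inv₀, hvS s' hs', inv_one, mul_one]
    exact hvS a ha
  refine ⟨?_, ?_, transportPlace_eft τ ι hsemi V hft, ?_, ?_, ?_, ?_⟩
  · intro c
    rw [transportPlace_mem_comap, hsemi]
    exact hk (ι c)
  · haveI := hdvr
    exact transportPlace_dvr V τ
  · intro x hx
    rw [ValuationSubring.mem_toSubring, transportPlace_mem_comap]
    exact hτR ⟨x, hx⟩
  · intro s hs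
    rw [transportPlace_mem_nonunits_comap, ValuationSubring.mem_nonunits_iff, hτunit s hs]
    exact lt_irrefl 1
  · intro r hr
    rw [transportPlace_mem_nonunits_comap]
    exact hcon r hr
  · intro r hr
    rw [transportPlace_mem_nonunits_comap]
    obtain ⟨a, s, hs, hτr, hiff⟩ := hτval r
    rw [hτr, map_mul, map_inv₀, ValuationSubring.mem_nonunits_iff, map_mul, map_inv₀, hτunit s hs,
      inv_one, mul_one]
    exact (V.mem_nonunits_iff).mp (hcon a (hiff.mp hr))

end Summit.ResolutionOfSingularities.ResolutionOfSingularities.Theorems
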